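import Literature.AnabelianGeometry.AbsoluteAnabelian.GaloisCyclotomeFunctoriality
import Literature.NumberTheory.GaloisRepresentations.AbsGaloisGroup
import Mathlib.FieldTheory.Galois.Infinite
import HarnessLib

/-!
# [AbsTopIII] Prop 3.2 (iv) / [AbsAnab] Prop 1.2.1 (iii),(iv): transporting `k̄^×` along an
# isomorphism of absolute Galois groups, LEVEL BY LEVEL (row "TLG lifting ⇐ LCFT facts by name",
# STAGE 2, brick 2)

Proof-only companion (theorems only, no new definitions).  Print ([AbsTopIII] Prop. 3.2 (iv) proof,
pp. 72–73, kurims `paper:url-5493eb38cbb7`): the multiplicative group of the algebraic closure is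
recovered from `G_k` by "considering the copy of `M ⥲ 𝒪^⊳_k` embedded in abelianizations of open
subgroups of `G ⥲ G_k` via local class field theory [cf. [Mzk9], Proposition 1.2.1, (iii), (iv)]" —
that is: for an open subgroup `U ≤ G_k` with fixed field `K_U`, the reciprocity map embeds `K_U^×`
into `U^ab`, and an isomorphism `α : G_{k₁} ⥲ G_{k₂}` carries these copies to each other ([AbsAnab]
Prop. 1.2.1 (iii)) compatibly with the Verlagerung (inclusions `K_U^× ⊆ K_V^×`).

This file is the LEVELWISE step, with the reciprocity families as explicit DATA and their properties
as explicit HYPOTHESES in the exact shapes the tree delivers them (abc-iut-L4-t11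
`exists_reciprocity_characterized_embField` p412840: injectivity, conjugation-equivariance;
`verlagerung_apply_eq_of_characterized` p414364: Verlagerung ↔ inclusion; the RANGE transport
hypothesis `hrange` = [AbsAnab] Prop. 1.2.1 (iii) for `Im(K^×)` at the finite levels, i.e.
`galoisMLF_iso_unitImage_holds` (p412652, 2nd conjunct) transported to the open subgroups — the one
adapter still to be supplied by the LCFT lane):

* `exists_levelUnitsIso` — for an open normal `U' ≤ G_{k₂}` and `U := α⁻¹(U')`, the composite
  `Art₂⁻¹ ∘ α^ab ∘ Art₁` is a multiplicative bijection `β_{U'} : K_U^× ⥲ K'_{U'}^×` (characterised by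
  `Art₂ (β u) = α^ab (Art₁ u)`);
* `levelUnitsIso_compatible` — for `V' ≤ U'` the bijections are compatible with the inclusions
  (`verlagerung_comap` + the Verlagerung clause);
* `levelUnitsIso_equivariant` — `β (σ u) = α(σ) β(u)` (conjugation clause, `U, U'` normal).

The gluing over all levels (⇒ the bi-anabelian statement (BA) of `MonoidKummerMapsTLGLiftReduction` /
`…Transport`) is the next file.  HONEST FRAMING: OUR kernel check of a reduction; nothing here bears
on [IUTchIII] Cor. 3.12.
-/

noncomputable section

open scoped Classical

namespace Literature.AnabelianGeometry.AbsoluteAnabelian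

open Field

section Levels

variable {k₁ k₂ : Type} [Field k₁] [Field k₂]

/-- The fixed field of a smaller subgroup is bigger. [folklore] -/
private theorem fixedField_mono {k : Type} [Field k] {U V : Subgroup (absoluteGaloisGroup k)}
    (h : V ≤ U) :
    IntermediateField.fixedField (U.map (absoluteGaloisGroup.toAlgEquiv k).toMonoidHom) ≤
      IntermediateField.fixedField (V.map (absoluteGaloisGroup.toAlgEquiv k).toMonoidHom) :=
  IntermediateField.fixedField_le (Subgroup.map_mono h)

/-- **Levelwise bijection.**  For an open subgroup `U' ≤ G_{k₂}`, `U := α⁻¹(U')`, reciprocity data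
`Art₁ : K_U^× → U^ab`, `Art₂ : K'_{U'}^× → U'^ab` with `Art₂` injective and `α^ab(range Art₁) = range Art₂`
([AbsAnab] Prop. 1.2.1 (iii)), there is a unique multiplicative bijection `β : K_U^× ⥲ K'_{U'}^×` with
`Art₂ ∘ β = α^ab ∘ Art₁`. [cite: MochizukiAbsAnab2004, Prop 1.2.1 (iii) p.10] -/
theorem exists_levelUnitsIso (α : absoluteGaloisGroup k₁ ≃ₜ* absoluteGaloisGroup k₂) (U' : Subgroup (absoluteGaloisGroup k₂))
    (Art₁ : (IntermediateField.fixedField ((U'.comap (α : absoluteGaloisGroup k₁ →* absoluteGaloisGroup k₂)).map (absoluteGaloisGroup.toAlgEquiv k₁).toMonoidHom))ˣ →*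
      TopologicalAbelianization (U'.comap (α : absoluteGaloisGroup k₁ →* absoluteGaloisGroup k₂)))
    (Art₂ : (IntermediateField.fixedField (U'.map (absoluteGaloisGroup.toAlgEquiv k₂).toMonoidHom))ˣ →* TopologicalAbelianization U')
    (hinj₁ : Function.Injective Art₁) (hinj₂ : Function.Injective Art₂)
    (hrange : ∀ t, t ∈ Set.range Art₁ ↔ abelianizationCongr (comapEquiv α U') t ∈ Set.range Art₂) :
    ∃ β : (IntermediateField.fixedField ((U'.comap (α : absoluteGaloisGroup k₁ →* absoluteGaloisGroup k₂)).map (absoluteGaloisGroup.toAlgEquiv k₁).toMonoidHom))ˣ ≃*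
        (IntermediateField.fixedField (U'.map (absoluteGaloisGroup.toAlgEquiv k₂).toMonoidHom))ˣ,
      ∀ u, Art₂ (β u) = abelianizationCongr (comapEquiv α U') (Art₁ u) := by
  -- the function
  have hex : ∀ u, ∃ v, Art₂ v = abelianizationCongr (comapEquiv α U') (Art₁ u) := fun u => by
    obtain ⟨v, hv⟩ := (hrange (Art₁ u)).mp ⟨u, rfl⟩
    exact ⟨v, hv⟩
  choose f hf using hex
  have hex' : ∀ v, ∃ u, abelianizationCongr (comapEquiv α U') (Art₁ u) = Art₂ v := fun v => by
    obtain ⟨t, ht⟩ := (abelianizationCongr (comapEquiv α U')).surjective (Art₂ v)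
    obtain ⟨u, hu⟩ := (hrange t).mpr ⟨v, ht.symm⟩
    exact ⟨u, by rw [hu, ht]⟩
  choose g hg using hex'
  refine ⟨{ toFun := f, invFun := g
            left_inv := fun u => hinj₁ ((abelianizationCongr (comapEquiv α U')).injective
              (by rw [hg, hf]))
            right_inv := fun v => hinj₂ (by rw [hf, hg])
            map_mul' := fun u v => hinj₂ (by rw [hf, map_mul, map_mul, map_mul, hf, hf]) }, hf⟩

/-- **Uniqueness of the levelwise bijection**: it is determined by `Art₂ ∘ β = α^ab ∘ Art₁`.
[cite: MochizukiAbsAnab2004, Prop 1.2.1 (iii) p.10] -/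
theorem levelUnitsIso_unique (α : absoluteGaloisGroup k₁ ≃ₜ* absoluteGaloisGroup k₂) (U' : Subgroup (absoluteGaloisGroup k₂))
    (Art₁ : (IntermediateField.fixedField ((U'.comap (α : absoluteGaloisGroup k₁ →* absoluteGaloisGroup k₂)).map (absoluteGaloisGroup.toAlgEquiv k₁).toMonoidHom))ˣ →*
      TopologicalAbelianization (U'.comap (α : absoluteGaloisGroup k₁ →* absoluteGaloisGroup k₂)))
    (Art₂ : (IntermediateField.fixedField (U'.map (absoluteGaloisGroup.toAlgEquiv k₂).toMonoidHom))ˣ →* TopologicalAbelianization U')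
    (hinj₂ : Function.Injective Art₂)
    {β β' : (IntermediateField.fixedField ((U'.comap (α : absoluteGaloisGroup k₁ →* absoluteGaloisGroup k₂)).map (absoluteGaloisGroup.toAlgEquiv k₁).toMonoidHom))ˣ →
        (IntermediateField.fixedField (U'.map (absoluteGaloisGroup.toAlgEquiv k₂).toMonoidHom))ˣ}
    (hβ : ∀ u, Art₂ (β u) = abelianizationCongr (comapEquiv α U') (Art₁ u))
    (hβ' : ∀ u, Art₂ (β' u) = abelianizationCongr (comapEquiv α U') (Art₁ u)) : β = β' :=
  funext fun u => hinj₂ (by rw [hβ, hβ'])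

/-- **Compatibility of the levelwise bijections with the inclusions** `K_U ⊆ K_V` (`V ≤ U`): this is
the Verlagerung clause of the reciprocity families (`Ver ∘ Art_U = Art_V ∘ incl`, Neukirch IV (5.9))
together with the naturality of the Verlagerung under `α` (`verlagerung_comap`).
[cite: MochizukiAbsAnab2004, Prop 1.2.1 (iii) p.10] -/
theorem levelUnitsIso_compatible [CompactSpace (absoluteGaloisGroup k₁)] [CompactSpace (absoluteGaloisGroup k₂)]
    (α : absoluteGaloisGroup k₁ ≃ₜ* absoluteGaloisGroup k₂) {U' V' : Subgroup (absoluteGaloisGroup k₂)}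
    (hU' : IsOpen (U' : Set (absoluteGaloisGroup k₂))) (hV' : IsOpen (V' : Set (absoluteGaloisGroup k₂))) (h : V' ≤ U')
    (ArtU₁ : (IntermediateField.fixedField ((U'.comap (α : absoluteGaloisGroup k₁ →* absoluteGaloisGroup k₂)).map (absoluteGaloisGroup.toAlgEquiv k₁).toMonoidHom))ˣ →*
      TopologicalAbelianization (U'.comap (α : absoluteGaloisGroup k₁ →* absoluteGaloisGroup k₂)))
    (ArtV₁ : (IntermediateField.fixedField ((V'.comap (α : absoluteGaloisGroup k₁ →* absoluteGaloisGroup k₂)).map (absoluteGaloisGroup.toAlgEquiv k₁).toMonoidHom))ˣ →*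
      TopologicalAbelianization (V'.comap (α : absoluteGaloisGroup k₁ →* absoluteGaloisGroup k₂)))
    (ArtU₂ : (IntermediateField.fixedField (U'.map (absoluteGaloisGroup.toAlgEquiv k₂).toMonoidHom))ˣ →* TopologicalAbelianization U')
    (ArtV₂ : (IntermediateField.fixedField (V'.map (absoluteGaloisGroup.toAlgEquiv k₂).toMonoidHom))ˣ →* TopologicalAbelianization V')
    (hinjV₂ : Function.Injective ArtV₂)
    (hVer₁ : ∀ u, verlagerung (hU'.preimage α.continuous) (hV'.preimage α.continuous)
        (Subgroup.comap_mono h) (ArtU₁ u) =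
      ArtV₁ (Units.map (IntermediateField.inclusion (fixedField_mono (k := k₁)
        (Subgroup.comap_mono (f := (α : absoluteGaloisGroup k₁ →* absoluteGaloisGroup k₂)) h))).toRingHom.toMonoidHom u))
    (hVer₂ : ∀ v, verlagerung hU' hV' h (ArtU₂ v) =
      ArtV₂ (Units.map (IntermediateField.inclusion (fixedField_mono (k := k₂) h)).toRingHom.toMonoidHom v))
    {βU : (IntermediateField.fixedField ((U'.comap (α : absoluteGaloisGroup k₁ →* absoluteGaloisGroup k₂)).map (absoluteGaloisGroup.toAlgEquiv k₁).toMonoidHom))ˣ →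
        (IntermediateField.fixedField (U'.map (absoluteGaloisGroup.toAlgEquiv k₂).toMonoidHom))ˣ}
    {βV : (IntermediateField.fixedField ((V'.comap (α : absoluteGaloisGroup k₁ →* absoluteGaloisGroup k₂)).map (absoluteGaloisGroup.toAlgEquiv k₁).toMonoidHom))ˣ →
        (IntermediateField.fixedField (V'.map (absoluteGaloisGroup.toAlgEquiv k₂).toMonoidHom))ˣ}
    (hβU : ∀ u, ArtU₂ (βU u) = abelianizationCongr (comapEquiv α U') (ArtU₁ u))
    (hβV : ∀ u, ArtV₂ (βV u) = abelianizationCongr (comapEquiv α V') (ArtV₁ u))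
    (u : (IntermediateField.fixedField ((U'.comap (α : absoluteGaloisGroup k₁ →* absoluteGaloisGroup k₂)).map (absoluteGaloisGroup.toAlgEquiv k₁).toMonoidHom))ˣ) :
    βV (Units.map (IntermediateField.inclusion (fixedField_mono (k := k₁)
        (Subgroup.comap_mono (f := (α : absoluteGaloisGroup k₁ →* absoluteGaloisGroup k₂)) h))).toRingHom.toMonoidHom u) =
      Units.map (IntermediateField.inclusion (fixedField_mono (k := k₂) h)).toRingHom.toMonoidHom (βU u) := by
  apply hinjV₂
  rw [hβV, ← hVer₁, verlagerung_comap α hU' hV' h, ← hβU, hVer₂]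

/-- **Equivariance of the levelwise bijection** (`U'`, hence `U = α⁻¹(U')`, NORMAL, so that `G` acts
on `K_U`): from the conjugation-equivariance of the reciprocity maps
(`Art(g·u) = g̃ Art(u) g̃⁻¹`, Neukirch IV (5.8)) on both sides, `β(σ u) = α(σ) β(u)` on underlying
elements. [cite: MochizukiAbsAnab2004, Prop 1.2.1 (iii) p.10] -/
theorem levelUnitsIso_equivariant (α : absoluteGaloisGroup k₁ ≃ₜ* absoluteGaloisGroup k₂) (U' : Subgroup (absoluteGaloisGroup k₂))
    (Art₁ : (IntermediateField.fixedField ((U'.comap (α : absoluteGaloisGroup k₁ →* absoluteGaloisGroup k₂)).map (absoluteGaloisGroup.toAlgEquiv k₁).toMonoidHom))ˣ →*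
      TopologicalAbelianization (U'.comap (α : absoluteGaloisGroup k₁ →* absoluteGaloisGroup k₂)))
    (Art₂ : (IntermediateField.fixedField (U'.map (absoluteGaloisGroup.toAlgEquiv k₂).toMonoidHom))ˣ →* TopologicalAbelianization U')
    (hinj₂ : Function.Injective Art₂)
    (hconj₁ : ∀ (g : absoluteGaloisGroup k₁) (u u' : (IntermediateField.fixedField ((U'.comap (α : absoluteGaloisGroup k₁ →* absoluteGaloisGroup k₂)).map (absoluteGaloisGroup.toAlgEquiv k₁).toMonoidHom))ˣ) (h h' : U'.comap (α : absoluteGaloisGroup k₁ →* absoluteGaloisGroup k₂)),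
      ((u' : IntermediateField.fixedField ((U'.comap (α : absoluteGaloisGroup k₁ →* absoluteGaloisGroup k₂)).map (absoluteGaloisGroup.toAlgEquiv k₁).toMonoidHom)) : AlgebraicClosure k₁) =
        g • ((u : IntermediateField.fixedField ((U'.comap (α : absoluteGaloisGroup k₁ →* absoluteGaloisGroup k₂)).map (absoluteGaloisGroup.toAlgEquiv k₁).toMonoidHom)) : AlgebraicClosure k₁) →
      (h' : absoluteGaloisGroup k₁) = g * h * g⁻¹ → Art₁ u = QuotientGroup.mk h → Art₁ u' = QuotientGroup.mk h')
    (hconj₂ : ∀ (g : absoluteGaloisGroup k₂) (v v' : (IntermediateField.fixedField (U'.map (absoluteGaloisGroup.toAlgEquiv k₂).toMonoidHom))ˣ) (h h' : U'),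
      ((v' : IntermediateField.fixedField (U'.map (absoluteGaloisGroup.toAlgEquiv k₂).toMonoidHom)) : AlgebraicClosure k₂) =
        g • ((v : IntermediateField.fixedField (U'.map (absoluteGaloisGroup.toAlgEquiv k₂).toMonoidHom)) : AlgebraicClosure k₂) →
      (h' : absoluteGaloisGroup k₂) = g * h * g⁻¹ → Art₂ v = QuotientGroup.mk h → Art₂ v' = QuotientGroup.mk h')
    {β : (IntermediateField.fixedField ((U'.comap (α : absoluteGaloisGroup k₁ →* absoluteGaloisGroup k₂)).map (absoluteGaloisGroup.toAlgEquiv k₁).toMonoidHom))ˣ →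
        (IntermediateField.fixedField (U'.map (absoluteGaloisGroup.toAlgEquiv k₂).toMonoidHom))ˣ}
    (hβ : ∀ u, Art₂ (β u) = abelianizationCongr (comapEquiv α U') (Art₁ u))
    (σ : absoluteGaloisGroup k₁) (u u' : (IntermediateField.fixedField ((U'.comap (α : absoluteGaloisGroup k₁ →* absoluteGaloisGroup k₂)).map (absoluteGaloisGroup.toAlgEquiv k₁).toMonoidHom))ˣ)
    (hu' : ((u' : IntermediateField.fixedField ((U'.comap (α : absoluteGaloisGroup k₁ →* absoluteGaloisGroup k₂)).map (absoluteGaloisGroup.toAlgEquiv k₁).toMonoidHom)) : AlgebraicClosure k₁) =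
      σ • ((u : IntermediateField.fixedField ((U'.comap (α : absoluteGaloisGroup k₁ →* absoluteGaloisGroup k₂)).map (absoluteGaloisGroup.toAlgEquiv k₁).toMonoidHom)) : AlgebraicClosure k₁))
    (v' : (IntermediateField.fixedField (U'.map (absoluteGaloisGroup.toAlgEquiv k₂).toMonoidHom))ˣ)
    (hv' : ((v' : IntermediateField.fixedField (U'.map (absoluteGaloisGroup.toAlgEquiv k₂).toMonoidHom)) : AlgebraicClosure k₂) =
      α σ • ((β u : IntermediateField.fixedField (U'.map (absoluteGaloisGroup.toAlgEquiv k₂).toMonoidHom)) : AlgebraicClosure k₂))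
    (hUσ : ∀ h : U'.comap (α : absoluteGaloisGroup k₁ →* absoluteGaloisGroup k₂), σ * h * σ⁻¹ ∈ U'.comap (α : absoluteGaloisGroup k₁ →* absoluteGaloisGroup k₂)) :
    β u' = v' := by
  -- write `Art₁ u = [h]`
  obtain ⟨h, hh⟩ := QuotientGroup.mk_surjective (Art₁ u)
  have h1 : Art₁ u' = QuotientGroup.mk ⟨σ * h * σ⁻¹, hUσ h⟩ := hconj₁ σ u u' h ⟨_, hUσ h⟩ hu' rfl hh.symm
  -- transport both through `α^ab`
  have h2 : Art₂ (β u) = QuotientGroup.mk (comapEquiv α U' h) := by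
    rw [hβ, ← hh, abelianizationCongr_mk]
  have hU'σ : (α σ : absoluteGaloisGroup k₂) * (comapEquiv α U' h : absoluteGaloisGroup k₂) * (α σ)⁻¹ ∈ U' := by
    have := (⟨σ * h * σ⁻¹, hUσ h⟩ : U'.comap (α : absoluteGaloisGroup k₁ →* absoluteGaloisGroup k₂)).2
    rw [Subgroup.mem_comap] at this
    simpa [coe_comapEquiv, map_mul, map_inv] using this
  have h3 : Art₂ v' = QuotientGroup.mk ⟨(α σ : absoluteGaloisGroup k₂) * (comapEquiv α U' h : absoluteGaloisGroup k₂) * (α σ)⁻¹, hU'σ⟩ :=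
    hconj₂ (α σ) (β u) v' (comapEquiv α U' h) ⟨_, hU'σ⟩ hv' rfl h2
  have h4 : Art₂ (β u') = QuotientGroup.mk ⟨(α σ : absoluteGaloisGroup k₂) * (comapEquiv α U' h : absoluteGaloisGroup k₂) * (α σ)⁻¹, hU'σ⟩ := by
    rw [hβ, h1, abelianizationCongr_mk]
    congr 1
    apply Subtype.ext
    simp [coe_comapEquiv, map_mul, map_inv]
  exact hinj₂ (h4.trans h3.symm)

end Levels

end Literature.AnabelianGeometry.AbsoluteAnabelian

end
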